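import Mathlib
import Literature.Analysis.FluidPDE.VectorCalculus
import Summits.NavierStokesRegularity.NavierStokesRegularity.Theorems.UnthreadedDoorFluxStarvedDipoleSphereFrame
import Summits.NavierStokesRegularity.NavierStokesRegularity.Theorems.UnthreadedDoorFluxStarvedDipoleLoopLaw
import HarnessLib

/-!
# Route `UnthreadedDoor`, crux `PoloidalLiouville` (stmt-NavierStokesRegularity-1222), wall W1 — crux idea
# «flux-starved-dipoles» (ns-idea-15 g12/g13, `Cruxes/PoloidalLiouville/FluxStarvedDipoleSketch.lean`):
# the lever for a GENERAL REDUCED SCALAR (towards the time-dependent `FluxStarvation`)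

The steady lever (`…LatitudeIdentity` p838473, `…FluxStarvation` p838510) used the reduced scalar `L = ⟪u,∇T⟫ − ΔT`.  The
time-dependent law (E1) (sketch `KinematicLawOn`) reads `∇(∂ₜT + ⟪u,∇T⟫ − ΔT) × (x−x₀) = ∇⟪u, x−x₀⟫ × ∇T`, i.e. the same law
with `ΔT` replaced by `Ψ = ΔT − ∂ₜT`, and on a dipolar sphere `∂ₜT(x₀ + y) = ⟪∂ₜA(t,r), y⟫/r + ∂ₜR(t,r)` is again affine in
`y`.  The pointwise proofs of p838473 use only that `Ψ` is differentiable off the centre and affine on `S_r(x₀)`; THIS FILE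
records them in that generality (same proofs, `Ψ` for `ΔT`):

* `loopMomentum_const_on_latitudeCircle_gen` (radial component of the law; `Ψ` arbitrary);
* `meridional_identity_gen`, `azimuthal_identity_gen` (`Ψ` differentiable off the centre, `Ψ(x₀ + y) = ⟪Cv, y⟫ + D` on `S_r`).

The sequel `…GeneralLeverTangency` adds `latitude_identity_gen` and tangency at non-solid radii.  HONEST LABEL: linear
kinematic shadow of W1 (critic V28: information-grade, W1 movement 0); `PoloidalLiouville` (1222), its wall `stub_scalarLiouville`
and the summit stay OPEN; NO Navier–Stokes regularity statement is proved.  `--supports stmt-NavierStokesRegularity-1222` (helper).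
[folklore]
-/

noncomputable section

-- the summit and its single sub-problem share the name (CONVENTIONS §1)
set_option linter.dupNamespace false

open Set Filter Topology InnerProductSpace
open scoped RealInnerProductSpace Laplacian
open Literature.Analysis.FluidPDE
open Summit.NavierStokesRegularity.NavierStokesRegularity.Theorems.PoloidalLiouville.HorizonTower (E3)
open Summit.NavierStokesRegularity.NavierStokesRegularity.Theorems.PoloidalLiouville.KinematicShadow (PointSource.cross_smul_right
  PointSource.cross_add_right PointSource.cross_self PointSource.cross_anticomm)
open Summit.NavierStokesRegularity.NavierStokesRegularity.Theorems.PoloidalLiouville.HorizonTower.Zonal (inner_cross_self_left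
  inner_cross_self_right norm_cross_sq cross_cross_left_of_orthonormal cross_cross_right_of_orthonormal frameBasis
  frameBasis_apply frameVec_zero frameVec_one frameVec_two)

namespace Summit.NavierStokesRegularity.NavierStokesRegularity.Theorems.PoloidalLiouville.FluxStarvedDipole

/-! ### The loop law -/

/-- **LOOP LAW (general reduced scalar): the loop momentum is constant on latitude circles.**  As
`loopMomentum_const_on_latitudeCircle` (p837304), but for the law `∇(⟪u,∇T⟫ − Ψ) × (x−x₀) = ∇⟪u, x−x₀⟫ × ∇T` with an
ARBITRARY scalar `Ψ` in place of `ΔT` (the proof only uses the radial component, in which `Ψ` does not appear).  Let `u ∈ C¹`, `A, R ∈ C³(0,∞)`, and let the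
law `∇(⟪u,∇T⟫ − Ψ) × (x−x₀) = ∇⟪u, x−x₀⟫ × ∇T` hold off the centre for the dipole potential `T`.  For
`r > 0` with `A(r) ≠ 0`, a unit vector `e ⊥ A(r)` and `c² + s² = 1`, the loop momentum `m = ⟪u, x − x₀⟫` is constant along the
latitude circle `φ ↦ x₀ + rc·Â(r) + rs·(cos φ·e + sin φ·(Â(r) × e))`.  (Radial component of the law:
`⟪∇m × ∇T, x−x₀⟫ = 0`; on `S_r`, `∇T = A(r)/r + κ·(x−x₀)`, and the circle's velocity is `Â × (x−x₀)`.) [folklore] -/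
theorem loopMomentum_const_on_latitudeCircle_gen (u : EuclideanSpace ℝ (Fin 3) → EuclideanSpace ℝ (Fin 3))
    (x₀ : EuclideanSpace ℝ (Fin 3)) (A : ℝ → EuclideanSpace ℝ (Fin 3)) (R : ℝ → ℝ)
    (hu : ContDiff ℝ 1 u) (hA : ContDiffOn ℝ 3 A (Set.Ioi 0)) (hR : ContDiffOn ℝ 3 R (Set.Ioi 0)) {Ψ : EuclideanSpace ℝ (Fin 3) → ℝ}
    (hlaw : ∀ x ∈ ({x₀}ᶜ : Set (EuclideanSpace ℝ (Fin 3))),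
      cross (gradient (fun z => ⟪u z, gradient (fun x => ⟪A ‖x - x₀‖, x - x₀⟫ / ‖x - x₀‖ + R ‖x - x₀‖) z⟫
          - Ψ z) x) (x - x₀)
        = cross (gradient (fun z => ⟪u z, z - x₀⟫) x)
            (gradient (fun x => ⟪A ‖x - x₀‖, x - x₀⟫ / ‖x - x₀‖ + R ‖x - x₀‖) x))
    {r : ℝ} (hr : 0 < r) (hAr : A r ≠ 0) {e : EuclideanSpace ℝ (Fin 3)} (he : ‖e‖ = 1) (hAe : ⟪A r, e⟫ = 0)
    {c s : ℝ} (hcs : c ^ 2 + s ^ 2 = 1) (φ₁ φ₂ : ℝ) :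
    ⟪u (x₀ + (r * c) • (‖A r‖⁻¹ • A r) + (r * s) • (Real.cos φ₁ • e + Real.sin φ₁ • cross (‖A r‖⁻¹ • A r) e)),
        (x₀ + (r * c) • (‖A r‖⁻¹ • A r) + (r * s) • (Real.cos φ₁ • e + Real.sin φ₁ • cross (‖A r‖⁻¹ • A r) e)) - x₀⟫
      = ⟪u (x₀ + (r * c) • (‖A r‖⁻¹ • A r) + (r * s) • (Real.cos φ₂ • e + Real.sin φ₂ • cross (‖A r‖⁻¹ • A r) e)),
        (x₀ + (r * c) • (‖A r‖⁻¹ • A r) + (r * s) • (Real.cos φ₂ • e + Real.sin φ₂ • cross (‖A r‖⁻¹ • A r) e)) - x₀⟫ := by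
  set T : EuclideanSpace ℝ (Fin 3) → ℝ := fun x => ⟪A ‖x - x₀‖, x - x₀⟫ / ‖x - x₀‖ + R ‖x - x₀‖ with hTdef
  have hT : ∀ z, T z = ⟪A ‖z - x₀‖, z - x₀⟫ / ‖z - x₀‖ + R ‖z - x₀‖ := fun z => rfl
  set m : EuclideanSpace ℝ (Fin 3) → ℝ := fun z => ⟪u z, z - x₀⟫ with hmdef
  set n : EuclideanSpace ℝ (Fin 3) := ‖A r‖⁻¹ • A r with hn
  have hAn0 : ‖A r‖ ≠ 0 := norm_ne_zero_iff.mpr hAr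
  have hn1 : ‖n‖ = 1 := by rw [hn, norm_smul, norm_inv, norm_norm, inv_mul_cancel₀ hAn0]
  have hne : ⟪n, e⟫ = 0 := by rw [hn, real_inner_smul_left, hAe, mul_zero]
  have hAn : A r = ‖A r‖ • n := by rw [hn, smul_smul, mul_inv_cancel₀ hAn0, one_smul]
  clear_value n
  set γ : ℝ → EuclideanSpace ℝ (Fin 3) :=
    fun φ => x₀ + (r * c) • n + (r * s) • (Real.cos φ • e + Real.sin φ • cross n e) with hγ
  -- `m` is differentiable, with derivative `⟪∇m, γ′⟫ = 0` along the circle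
  have hmd : ∀ z, DifferentiableAt ℝ m z := fun z =>
    (hu.differentiable one_ne_zero z).inner ℝ (differentiableAt_id.sub (differentiableAt_const x₀))
  have hderiv : ∀ φ, HasDerivAt (fun φ => m (γ φ)) 0 φ := by
    intro φ
    have hγ' := hasDerivAt_latitudeCircle n e x₀ r c s φ
    have hcomp : HasDerivAt (fun φ => m (γ φ))
        (fderiv ℝ m (γ φ) ((r * s) • ((-Real.sin φ) • e + Real.cos φ • cross n e))) φ :=
      (hmd (γ φ)).hasFDerivAt.comp_hasDerivAt φ hγ'
    refine hcomp.congr_deriv ?_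
    -- the point is on the sphere, off the centre
    have hsph : ‖γ φ - x₀‖ = r := latitudeCircle_mem_sphere hn1 he hne hr hcs φ
    have hp : γ φ ≠ x₀ := by
      intro h; rw [h, sub_self, norm_zero] at hsph; exact hr.ne' hsph.symm
    -- the radial component of the law at `γ φ`
    have hE := hlaw (γ φ) hp
    have hrad : ⟪cross (gradient m (γ φ)) (gradient T (γ φ)), γ φ - x₀⟫ = 0 := by
      rw [← hE]; exact inner_cross_self_right _ _
    -- `∇T` on the sphere
    obtain ⟨κ, hκ⟩ := dipole_gradient_sphere hT hA hR hr hsph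
    rw [add_sub_cancel] at hκ
    rw [hκ, hAn, smul_smul, PointSource.cross_add_right, PointSource.cross_smul_right, PointSource.cross_smul_right,
      inner_add_left, real_inner_smul_left, real_inner_smul_left, inner_cross_self_right, mul_zero, add_zero] at hrad
    have hkey : ⟪cross (gradient m (γ φ)) n, γ φ - x₀⟫ = 0 := by
      rcases mul_eq_zero.mp hrad with h | h
      · exact absurd h (mul_ne_zero (inv_ne_zero hr.ne') hAn0)
      · exact h
    rw [← InnerProductSpace.toDual_symm_apply, ← gradient, ← cross_axis_latitudeCircle hn1 hne r c s φ,
      inner_cross_right_eq_inner_cross_left]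
    exact hkey
  have hdiff : Differentiable ℝ fun φ => m (γ φ) := fun φ => (hderiv φ).differentiableAt
  exact is_const_of_deriv_eq_zero hdiff (fun φ => (hderiv φ).deriv) φ₁ φ₂

/-! ### The meridional identity -/

/-- **MERIDIONAL IDENTITY, general reduced scalar** (as `meridional_identity`, p838473, with an arbitrary scalar `Ψ`,
differentiable off the centre and affine on the sphere, in place of `ΔT`; θ-derivative of the reduced scalar law along a meridian of a dipolar sphere).  Setting: `u ∈ C¹`,
`A, R ∈ C³(0,∞)`, the dipole potential `T` and the steady kinematic law off the centre (sketch shapes, unfolded); `r > 0`,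
`A(r) = a·n ≠ 0` with `n` a unit vector, `ρ ⊥ n` a unit vector, `ΔT(x₀ + y) = ⟪Cv, y⟫ + D` on `S_r` (`dipole_laplacian_sphere`);
the point `x = x₀ + y`, `y = r cos θ·n + r sin θ·ρ`, with frame `ξ̂ = cos θ·n + sin θ·ρ`, `θ̂ = −sin θ·n + cos θ·ρ`.  Then
`a cos θ·u_θ + a sin θ·(r⟪θ̂, Du θ̂⟫ − u_ξ) = ⟪A′(r), θ̂⟫·m − a sin θ·Dm[ξ̂] − r²⟪Cv, θ̂⟫` (`m = ⟪u, x − x₀⟫`).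
Proof: along the meridian, `a sin θ·u_θ = ⟪∇T, y⟫ m/r − r L − r ΔT` (`meridional_drift`, `∇T = A(r)/r + κy`); differentiate
both sides in `θ` (`⟪∇T, y⟫ = ⟪A′(r), y⟫ + rR′(r)` by `dipole_fderiv_radial`), and eliminate `DL[θ̂]` with the azimuthal component
of the law (`law_azimuthal`). [folklore] -/
theorem meridional_identity_gen (u : E3 → E3) (x₀ : E3) (A : ℝ → E3) (R : ℝ → ℝ)
    (hu : ContDiff ℝ 1 u) (hA : ContDiffOn ℝ 3 A (Set.Ioi 0)) (hR : ContDiffOn ℝ 3 R (Set.Ioi 0)) {Ψ : E3 → ℝ}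
    (hlaw : ∀ x ∈ ({x₀}ᶜ : Set E3),
      cross (gradient (fun z => ⟪u z, gradient (fun x => ⟪A ‖x - x₀‖, x - x₀⟫ / ‖x - x₀‖ + R ‖x - x₀‖) z⟫
          - Ψ z) x) (x - x₀)
        = cross (gradient (fun z => ⟪u z, z - x₀⟫) x)
            (gradient (fun x => ⟪A ‖x - x₀‖, x - x₀⟫ / ‖x - x₀‖ + R ‖x - x₀‖) x))
    {r : ℝ} (hr : 0 < r) {n ρ : E3} (hn : ‖n‖ = 1) (hAn : A r = ‖A r‖ • n) (hρ : ‖ρ‖ = 1)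
    (hnρ : ⟪n, ρ⟫ = 0) {Cv : E3} {D : ℝ}
    (hΨd : ∀ x : E3, x ≠ x₀ → DifferentiableAt ℝ Ψ x) (hQ : ∀ y : E3, ‖y‖ = r → Ψ (x₀ + y) = ⟪Cv, y⟫ + D)
    (θ : ℝ) {x ξ τ : E3} (hx : x = x₀ + ((r * Real.cos θ) • n + (r * Real.sin θ) • ρ))
    (hξ : ξ = Real.cos θ • n + Real.sin θ • ρ) (hτ : τ = (-Real.sin θ) • n + Real.cos θ • ρ) :
    ‖A r‖ * Real.cos θ * ⟪u x, τ⟫ + ‖A r‖ * Real.sin θ * (r * ⟪τ, fderiv ℝ u x τ⟫ - ⟪u x, ξ⟫)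
      = ⟪deriv A r, τ⟫ * ⟪u x, x - x₀⟫ - ‖A r‖ * Real.sin θ * fderiv ℝ (fun z => ⟪u z, z - x₀⟫) x ξ
        - r ^ 2 * ⟪Cv, τ⟫ := by
  set a : ℝ := ‖A r‖ with ha
  set T : E3 → ℝ := fun x => ⟪A ‖x - x₀‖, x - x₀⟫ / ‖x - x₀‖ + R ‖x - x₀‖ with hTdef
  have hT : ∀ z, T z = ⟪A ‖z - x₀‖, z - x₀⟫ / ‖z - x₀‖ + R ‖z - x₀‖ := fun z => rfl
  set m : E3 → ℝ := fun z => ⟪u z, z - x₀⟫ with hmdef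
  set L : E3 → ℝ := fun z => ⟪u z, gradient T z⟫ - Ψ z with hLdef
  -- the meridian, its points, its frame
  set yv : ℝ → E3 := fun θ' => (r * Real.cos θ') • n + (r * Real.sin θ') • ρ with hyv
  set β : ℝ → E3 := fun θ' => x₀ + yv θ' with hβ
  set τf : ℝ → E3 := fun θ' => (-Real.sin θ') • n + Real.cos θ' • ρ with hτf
  have hβx : β θ = x := by rw [hx]
  have hτθ : τf θ = τ := by rw [hτ]
  have hβy : ∀ θ', β θ' - x₀ = yv θ' := fun θ' => add_sub_cancel_left _ _
  have hyn : ∀ θ', ‖yv θ'‖ = r := fun θ' => norm_meridianVec hn hρ hnρ hr.le θ'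
  have hβne : ∀ θ', β θ' ≠ x₀ := by
    intro θ' h
    have h1 := hyn θ'
    rw [← hβy, h, sub_self, norm_zero] at h1
    exact hr.ne h1
  have hβ' : ∀ θ', HasDerivAt β (r • τf θ') θ' := fun θ' => (hasDerivAt_meridianVec n ρ r θ').const_add x₀
  have hτ' : ∀ θ', HasDerivAt τf (-(Real.cos θ' • n + Real.sin θ' • ρ)) θ' := fun θ' => hasDerivAt_thetaHat n ρ θ'
  -- differentiability of `m` everywhere and of `L` off the centre
  have hmd : ∀ z, DifferentiableAt ℝ m z := fun z =>
    (hu.differentiable one_ne_zero z).inner ℝ (differentiableAt_id.sub (differentiableAt_const x₀))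
  have hLd : ∀ z, z ≠ x₀ → DifferentiableAt ℝ L z := by
    intro z hz
    have h3 := dipole_contDiffAt hT hA hR hz
    exact ((hu.differentiable one_ne_zero z).inner ℝ (dipole_differentiableAt_gradient h3)).sub (hΨd z hz)
  -- `∇T` on the sphere, the radial derivative `⟪∇T, y⟫`, and `ΔT` along the meridian
  have hGT : ∀ θ', ∃ κ : ℝ, gradient T (β θ') = (r⁻¹ * a) • n + κ • yv θ' := by
    intro θ'
    obtain ⟨κ, hκ⟩ := dipole_gradient_sphere (x₀ := x₀) hT hA hR hr (hyn θ')
    exact ⟨κ, by rw [hκ, hAn, smul_smul]⟩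
  have hEr : ∀ θ', ⟪gradient T (β θ'), yv θ'⟫ = ⟪deriv A r, yv θ'⟫ + r * deriv R r := by
    intro θ'
    rw [HorizonTower.inner_gradient_eq_fderiv, ← hβy, dipole_fderiv_radial hT hA hR (hβne θ'), hβy, hyn]
  have hQ' : ∀ θ', Ψ (β θ') = ⟪Cv, yv θ'⟫ + D := fun θ' => hQ _ (hyn θ')
  -- the pointwise identity `a sin θ' u_θ = ⟪∇T,y⟫ m / r − r L − r ΔT` (times `r`)
  have hpt : ∀ θ', r * (a * Real.sin θ' * ⟪u (β θ'), τf θ'⟫) =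
      (⟪deriv A r, yv θ'⟫ + r * deriv R r) * m (β θ') - r * (r * L (β θ')) - r * (r * (⟪Cv, yv θ'⟫ + D)) := by
    intro θ'
    obtain ⟨κ, hκ⟩ := hGT θ'
    have hmd' : r * (r * ⟪u (β θ'), (r⁻¹ * a) • n + κ • yv θ'⟫) =
        ⟪(r⁻¹ * a) • n + κ • yv θ', yv θ'⟫ * ⟪u (β θ'), yv θ'⟫ - r * (r * (r⁻¹ * a) * Real.sin θ' * ⟪u (β θ'), τf θ'⟫) :=
      meridional_drift hn hρ hnρ (Real.cos_sq_add_sin_sq θ') r (r⁻¹ * a) κ (u (β θ'))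
    have hra : r * (r⁻¹ * a) = a := by field_simp
    rw [hra] at hmd'
    have hLval : L (β θ') = ⟪u (β θ'), gradient T (β θ')⟫ - Ψ (β θ') := rfl
    have hm : m (β θ') = ⟪u (β θ'), yv θ'⟫ := by simp only [hmdef, hβy]
    rw [hLval, hQ', ← hEr θ', hκ, hm]
    linear_combination hmd'
  -- (a) the derivative of `θ' ↦ r·a sin θ'·u_θ` by the kinematic chain rule
  have hUτ : HasDerivAt (fun θ' => ⟪u (β θ'), τf θ'⟫)
      (⟪u (β θ), -(Real.cos θ • n + Real.sin θ • ρ)⟫ + ⟪fderiv ℝ u (β θ) (r • τf θ), τf θ⟫) θ := by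
    have hU : HasDerivAt (fun θ' => u (β θ')) (fderiv ℝ u (β θ) (r • τf θ)) θ :=
      (hu.differentiable one_ne_zero (β θ)).hasFDerivAt.comp_hasDerivAt θ (hβ' θ)
    exact hU.inner ℝ (hτ' θ)
  have hg1 : HasDerivAt (fun θ' => r * (a * Real.sin θ' * ⟪u (β θ'), τf θ'⟫))
      (r * (a * Real.cos θ * ⟪u (β θ), τf θ⟫ + a * Real.sin θ *
        (⟪u (β θ), -(Real.cos θ • n + Real.sin θ • ρ)⟫ + ⟪fderiv ℝ u (β θ) (r • τf θ), τf θ⟫))) θ := by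
    have hs : HasDerivAt (fun θ' => a * Real.sin θ') (a * Real.cos θ) θ := (Real.hasDerivAt_sin θ).const_mul a
    exact (hs.mul hUτ).const_mul r
  -- (b) the derivative of the right-hand side
  have hyv' : HasDerivAt yv (r • τf θ) θ := hasDerivAt_meridianVec n ρ r θ
  have hmD : HasDerivAt (fun θ' => m (β θ')) (fderiv ℝ m (β θ) (r • τf θ)) θ :=
    (hmd (β θ)).hasFDerivAt.comp_hasDerivAt θ (hβ' θ)
  have hLD : HasDerivAt (fun θ' => L (β θ')) (fderiv ℝ L (β θ) (r • τf θ)) θ :=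
    (hLd (β θ) (hβne θ)).hasFDerivAt.comp_hasDerivAt θ (hβ' θ)
  have hED : HasDerivAt (fun θ' => ⟪deriv A r, yv θ'⟫ + r * deriv R r) (⟪deriv A r, r • τf θ⟫) θ := by
    have h := ((hasDerivAt_const θ (deriv A r)).inner ℝ hyv').add_const (r * deriv R r)
    simpa only [inner_zero_left, zero_add, add_zero] using h
  have hQD : HasDerivAt (fun θ' => ⟪Cv, yv θ'⟫ + D) (⟪Cv, r • τf θ⟫) θ := by
    have h := ((hasDerivAt_const θ Cv).inner ℝ hyv').add_const D
    simpa only [inner_zero_left, zero_add, add_zero] using h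
  have hg2 : HasDerivAt (fun θ' => (⟪deriv A r, yv θ'⟫ + r * deriv R r) * m (β θ') - r * (r * L (β θ'))
        - r * (r * (⟪Cv, yv θ'⟫ + D)))
      (⟪deriv A r, r • τf θ⟫ * m (β θ) + (⟪deriv A r, yv θ⟫ + r * deriv R r) * fderiv ℝ m (β θ) (r • τf θ)
        - r * (r * fderiv ℝ L (β θ) (r • τf θ)) - r * (r * ⟪Cv, r • τf θ⟫)) θ :=
    ((hED.mul hmD).sub ((hLD.const_mul r).const_mul r)).sub ((hQD.const_mul r).const_mul r)
  -- (c) the two functions coincide, hence so do the derivatives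
  have hfun : (fun θ' => r * (a * Real.sin θ' * ⟪u (β θ'), τf θ'⟫)) =
      fun θ' => (⟪deriv A r, yv θ'⟫ + r * deriv R r) * m (β θ') - r * (r * L (β θ')) - r * (r * (⟪Cv, yv θ'⟫ + D)) :=
    funext hpt
  rw [hfun] at hg1
  have huniq := hg1.unique hg2
  -- (d) the azimuthal component of the law at `x`
  have hxne : x ≠ x₀ := by rw [← hβx]; exact hβne θ
  obtain ⟨κ, hκ⟩ := hGT θ
  have hE := hlaw x hxne
  have hxy : x - x₀ = yv θ := by rw [← hβx]; exact hβy θ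
  rw [hxy, ← hβx, hκ] at hE
  have hB := law_azimuthal hn hρ hnρ (Real.cos_sq_add_sin_sq θ) r (r⁻¹ * a) κ (gradient L (β θ)) (gradient m (β θ)) hE
  rw [← hκ, hEr θ, HorizonTower.inner_gradient_eq_fderiv, HorizonTower.inner_gradient_eq_fderiv,
    HorizonTower.inner_gradient_eq_fderiv] at hB
  have hra : r * (r⁻¹ * a) = a := by field_simp
  rw [hra] at hB
  -- (e) assemble
  rw [map_smul, map_smul, map_smul, inner_smul_left, inner_smul_right, inner_smul_right, inner_neg_right] at huniq
  simp only [smul_eq_mul] at huniq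
  rw [hβx, hτθ, ← hξ] at huniq
  rw [← hτ, ← hξ, hβx] at hB
  have hmx : m x = ⟪u x, x - x₀⟫ := rfl
  rw [← hmx]
  rw [real_inner_comm (τ : E3) (fderiv ℝ u x τ)] at huniq
  have hr0 : r ≠ 0 := hr.ne'
  -- `huniq`: r(a cos θ u_θ + a sin θ (r⟪Du τ,τ⟫ − u_ξ)) = r⟪A′,τ⟫ m + Er·r·Dm τ − r·r·(r DL τ) − r·r·r⟪Cv,τ⟫
  -- `hB`   : r·r·DL τ = Er·Dm τ + a sin θ·Dm ξ
  have key : r * (a * Real.cos θ * ⟪u x, τ⟫ + a * Real.sin θ * (r * ⟪τ, fderiv ℝ u x τ⟫ - ⟪u x, ξ⟫))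
      = r * (⟪deriv A r, τ⟫ * m x - a * Real.sin θ * fderiv ℝ m x ξ - r ^ 2 * ⟪Cv, τ⟫) := by
    linear_combination huniq - r * hB
  exact mul_left_cancel₀ hr0 key

/-! ### The azimuthal strain identity (pointwise incompressibility in the moving frame) -/

/-- **AZIMUTHAL STRAIN IDENTITY, general reduced scalar** (as `azimuthal_identity`, p838473).  In the setting of
`meridional_identity_gen`, if moreover `div u = 0`, then at the point
`x = x₀ + r cos θ·n + r sin θ·ρ` the azimuthal strain `⟪φ̂, Du φ̂⟫` (`φ̂ = n × ρ`) satisfies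
`a·r sin θ·⟪φ̂, Du φ̂⟫ = a cos θ·u_θ − ⟪A′(r), θ̂⟫·m + r²⟪Cv, θ̂⟫`
(`div u = ⟪ξ̂,Du ξ̂⟫ + ⟪θ̂,Du θ̂⟫ + ⟪φ̂,Du φ̂⟫`, the radial strain is `(Dm[ξ̂] − u_ξ)/r`, the meridional one comes from
`meridional_identity`; the radial derivative `Dm[ξ̂]` cancels). [folklore] -/
theorem azimuthal_identity_gen (u : E3 → E3) (x₀ : E3) (A : ℝ → E3) (R : ℝ → ℝ)
    (hu : ContDiff ℝ 1 u) (hdiv : Literature.Analysis.FluidPDE.VectorCalculus.IsDivFree u)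
    (hA : ContDiffOn ℝ 3 A (Set.Ioi 0)) (hR : ContDiffOn ℝ 3 R (Set.Ioi 0)) {Ψ : E3 → ℝ}
    (hlaw : ∀ x ∈ ({x₀}ᶜ : Set E3),
      cross (gradient (fun z => ⟪u z, gradient (fun x => ⟪A ‖x - x₀‖, x - x₀⟫ / ‖x - x₀‖ + R ‖x - x₀‖) z⟫
          - Ψ z) x) (x - x₀)
        = cross (gradient (fun z => ⟪u z, z - x₀⟫) x)
            (gradient (fun x => ⟪A ‖x - x₀‖, x - x₀⟫ / ‖x - x₀‖ + R ‖x - x₀‖) x))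
    {r : ℝ} (hr : 0 < r) {n ρ : E3} (hn : ‖n‖ = 1) (hAn : A r = ‖A r‖ • n) (hρ : ‖ρ‖ = 1)
    (hnρ : ⟪n, ρ⟫ = 0) {Cv : E3} {D : ℝ}
    (hΨd : ∀ x : E3, x ≠ x₀ → DifferentiableAt ℝ Ψ x) (hQ : ∀ y : E3, ‖y‖ = r → Ψ (x₀ + y) = ⟪Cv, y⟫ + D)
    (θ : ℝ) {x ξ τ : E3} (hx : x = x₀ + ((r * Real.cos θ) • n + (r * Real.sin θ) • ρ))
    (hξ : ξ = Real.cos θ • n + Real.sin θ • ρ) (hτ : τ = (-Real.sin θ) • n + Real.cos θ • ρ) :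
    ‖A r‖ * (r * Real.sin θ) * ⟪cross n ρ, fderiv ℝ u x (cross n ρ)⟫ =
      ‖A r‖ * Real.cos θ * ⟪u x, τ⟫ - ⟪deriv A r, τ⟫ * ⟪u x, x - x₀⟫ + r ^ 2 * ⟪Cv, τ⟫ := by
  have hM := meridional_identity_gen u x₀ A R hu hA hR hlaw hr hn hAn hρ hnρ hΨd hQ θ hx hξ hτ
  subst hξ hτ
  obtain ⟨hξ1, hτ1, hξτ, hp⟩ := movingFrame_facts hn hρ hnρ (Real.cos_sq_add_sin_sq θ)
  have hdiv0 := hdiv x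
  rw [divergence_pairFrame u x hξ1 hτ1 hξτ, hp] at hdiv0
  -- the radial strain through the loop momentum: `Dm[ξ̂] = r⟪ξ̂, Du ξ̂⟫ + u_ξ`
  have hxξ : x - x₀ = r • (Real.cos θ • n + Real.sin θ • ρ) := by
    rw [hx, add_sub_cancel_left, smul_add, smul_smul, smul_smul]
  have hmξ : fderiv ℝ (fun z => ⟪u z, z - x₀⟫) x (Real.cos θ • n + Real.sin θ • ρ) =
      r * ⟪Real.cos θ • n + Real.sin θ • ρ, fderiv ℝ u x (Real.cos θ • n + Real.sin θ • ρ)⟫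
        + ⟪u x, Real.cos θ • n + Real.sin θ • ρ⟫ := by
    have h1 : HasFDerivAt u (fderiv ℝ u x) x := (hu.differentiable one_ne_zero x).hasFDerivAt
    have h2 : HasFDerivAt (fun z : E3 => z - x₀) (ContinuousLinearMap.id ℝ E3) x := (hasFDerivAt_id x).sub_const x₀
    rw [(h1.inner ℝ h2).fderiv]
    simp only [ContinuousLinearMap.coe_comp, Function.comp_apply, ContinuousLinearMap.prod_apply,
      fderivInnerCLM_apply, ContinuousLinearMap.coe_id', id_eq]
    rw [hxξ, inner_smul_right,
      real_inner_comm (Real.cos θ • n + Real.sin θ • ρ) (fderiv ℝ u x (Real.cos θ • n + Real.sin θ • ρ))]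
    ring
  linear_combination (‖A r‖ * (r * Real.sin θ)) * hdiv0 - hM + ‖A r‖ * Real.sin θ * hmξ


end Summit.NavierStokesRegularity.NavierStokesRegularity.Theorems.PoloidalLiouville.FluxStarvedDipole

end
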